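import Mathlib
import Literature.Topology.FourManifolds.BandFrames

/-!
# An immersion is locally injective

For a smooth map `v : ℂ → ℝ⁴` whose differential at `ξ` is injective, `v` is injective on a small
closed disc about `ξ`.  This is the tree's
`Literature.Topology.FourManifolds.exists_nhds_injOn_of_injective_fderiv` (Hirsch (1976), Ch. 2
§1, Lemma 1.3: a strictly differentiable map with injective differential is injective on a
neighbourhood), specialised to a closed disc inside that neighbourhood; smoothness supplies the
strict differentiability.
-/

set_option linter.dupNamespace false

noncomputable section

open Filter Set Metric
open scoped ContDiff Topology

namespace Summit.SmoothPoincare4.SmoothPoincare4.Cruxes.TameOrBrodyR4.Sketch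

/-- Local notation for the model space `ℝ⁴ = EuclideanSpace ℝ (Fin 4)`. -/
local notation "E4" => EuclideanSpace ℝ (Fin 4)

/-- (LI) an immersion is locally injective (finite-dimensional source and target). -/
theorem helper_immersionLocallyInjective (v : ℂ → E4) (ξ : ℂ) (hv : ContDiff ℝ ∞ v)
    (himm : Function.Injective (fderiv ℝ v ξ)) :
    ∃ r : ℝ, 0 < r ∧ InjOn v (closedBall ξ r) := by
  have hstrict : HasStrictFDerivAt v (fderiv ℝ v ξ) ξ :=
    hv.contDiffAt.hasStrictFDerivAt (by simp)
  obtain ⟨U, hU, hinj⟩ :=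
    Literature.Topology.FourManifolds.exists_nhds_injOn_of_injective_fderiv hstrict himm
  obtain ⟨r, hr, hrU⟩ := Metric.nhds_basis_closedBall.mem_iff.1 hU
  exact ⟨r, hr, hinj.mono hrU⟩

end Summit.SmoothPoincare4.SmoothPoincare4.Cruxes.TameOrBrodyR4.Sketch
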